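import Summits.QuantumFields.QCD.Theses.PauliWegnerSea
import Literature.MathematicalPhysics.QuantumFieldTheory.StrongCouplingActivities
import Literature.MathematicalPhysics.QuantumFieldTheory.QCDPhaseQuenched

/-!
# Crux `TiltedFlatness` (stmt-QuantumFields-14070), line `circle-transport` — stub `stub_haarSmallBalls`

HAAR RELATIVE SMALL BALLS FROM THE FLAT TORUS (the lead's stub).  For a one-parameter family
`T : ℝ → SU(3)` with matrix form `diag(e^{iθ}, e^{-iθ}, 1)`, a FIXED surjective word
`g = Π_j V_j T(s_j) V_j⁻¹` of conjugated circles, and the flat-torus small-ball estimate for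
continuous non-negative functions on `ℝ^m` that are trigonometric polynomials of degree `≤ D` in each
variable separately, we prove: for every continuous `F ≥ 0` on `SU(3)^E` depending on at most `n`
listed coordinates `r : ι → E` whose SQUARE is a trigonometric polynomial of degree `≤ D` along every
two-sided circle `t ↦ W[r i ↦ A T(t) B]`, `Haar^{⊗E}{F ≤ ε F(W₀)} ≤ C ε^c` for every `W₀` with
`F(W₀) > 0`, with `C, c` depending on `D, n` (and the word) only.

Proof (exact coupling + ontoness; no Jacobians).  For angles `θ : Fin m → ℝ`,
`m = #(ι × Fin d) ≤ n·d`, let `g_θ ∈ SU(3)^E` carry at every listed coordinate `e = r i₀` (`i₀` a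
chosen preimage) the word with the angles of `i₀`, and `1` elsewhere.  Left invariance of product Haar
and Tonelli give `Leb(box) · Haar(A) = ∫ Leb{θ ∈ box : g_θ W' ∈ A} dHaar(W')`, `box = [-π,π]^m`
(`lintegral_le_of_fibre`).  For `A = {F ≤ ε F(W₀)}` and EVERY `W'`, the fibre function
`q(θ) = F(g_θ W')²` is continuous, `≥ 0`, a trigonometric polynomial of degree `≤ D` in each angle
(one angle = one move `A T(t) B` at one listed coordinate, `prod_ofFn_update`; ignored angles give
constants), and takes the value `F(W₁)² ≥ F(W₀)² > 0` at the angles `θ⋆` that carry `W'` to the global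
maximiser `W₁` on the listed coordinates (surjectivity of the word + dependence on listed
coordinates).  Hence `{θ ∈ box : g_θ W' ∈ A} ⊆ {q ≤ ε² q(θ⋆)}`, of Lebesgue measure `≤ C_m ε^{2c_m}`
by the torus estimate, uniformly in `W'`; divide by `Leb(box) = (2π)^m ≥ 1`.
Sources: folklore (Haar averaging along one-parameter subgroups; Fefferman–Ghosh–Zhan-type
anti-concentration on compact groups via abelian fibres); line card `circle-transport` §6.
-/

noncomputable section

namespace Summit.QuantumFields.QCD.Theorems.CircleTransport

open scoped BigOperators Real Matrix.Norms.L2Operator ENNReal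
open MeasureTheory Set Filter
open Literature.MathematicalPhysics.QuantumFieldTheory Literature.MathematicalPhysics.QuantumLattice
  Literature.Probability.LatticeModels

/-- `SU(3)` (the tree's `Matrix.specialUnitaryGroup (Fin 3) ℂ`). -/
local notation "SU3" => Matrix.specialUnitaryGroup (Fin 3) ℂ

/-- Splitting an ordered product at one factor: the product of `List.ofFn (update f j y)` is
`A * y * B` with `A`, `B` independent of `y`. -/
private theorem prod_ofFn_update' {G : Type*} [Monoid G] :
    ∀ (d : ℕ) (f : Fin d → G) (j : Fin d), ∃ A B : G, ∀ y : G,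
      (List.ofFn (Function.update f j y)).prod = A * y * B
  | 0, _, j => j.elim0
  | d + 1, f, j => by
    obtain rfl | ⟨j', rfl⟩ := Fin.eq_zero_or_eq_succ j
    · refine ⟨1, (List.ofFn fun i : Fin d => f i.succ).prod, fun y => ?_⟩
      have h1 : (fun i : Fin d => Function.update f 0 y i.succ) = fun i => f i.succ :=
        funext fun i => Function.update_of_ne (Fin.succ_ne_zero i) _ _
      rw [List.ofFn_succ, List.prod_cons, Function.update_self, h1, one_mul]
    · obtain ⟨A, B, hAB⟩ := prod_ofFn_update' d (fun i : Fin d => f i.succ) j'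
      refine ⟨f 0 * A, B, fun y => ?_⟩
      rw [List.ofFn_succ, List.prod_cons, Function.update_of_ne (Fin.succ_ne_zero j').symm,
        Function.update_comp_eq_of_injective' f (Fin.succ_injective d) j' y, hAB]
      simp only [mul_assoc]

/-- A family with the matrix form `diag(e^{iθ}, e^{-iθ}, 1)` is continuous. -/
private theorem continuous_of_coe_eq' (T : ℝ → SU3)
    (hT : ∀ θ : ℝ, ((T θ : SU3) : Matrix (Fin 3) (Fin 3) ℂ) =
      Matrix.diagonal ![Complex.exp (θ * Complex.I), Complex.exp (-(θ * Complex.I)), 1]) :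
    Continuous T := by
  refine continuous_induced_rng.2 ?_
  have : ((↑) ∘ T : ℝ → Matrix (Fin 3) (Fin 3) ℂ) = fun θ : ℝ =>
      Matrix.diagonal
        ![Complex.exp ((θ : ℂ) * Complex.I), Complex.exp (-((θ : ℂ) * Complex.I)), 1] :=
    funext hT
  rw [this]
  refine Continuous.matrix_diagonal (continuous_pi fun i => ?_)
  fin_cases i <;> simp <;> fun_prop

/-- The word coupling, upper form: if for every point the fibre integral of `F` along the left
translates `g θ * x` is at most `c`, then `ν(univ) · ∫ F dμ ≤ c` (left invariance + Tonelli). -/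
private theorem lintegral_le_of_fibre {X P : Type*} [MeasurableSpace X] [Group X]
    [MeasurableMul X] (μ : Measure X) [μ.IsMulLeftInvariant] [IsProbabilityMeasure μ]
    [MeasurableSpace P] (ν : Measure P) [SFinite ν] (g : P → X) (F : X → ℝ≥0∞)
    (hF : Measurable fun p : P × X => F (g p.1 * p.2)) (c : ℝ≥0∞)
    (hc : ∀ x, ∫⁻ θ, F (g θ * x) ∂ν ≤ c) : ν univ * ∫⁻ x, F x ∂μ ≤ c := by
  calc ν univ * ∫⁻ x, F x ∂μ = ∫⁻ _θ, ∫⁻ x, F x ∂μ ∂ν := by rw [lintegral_const, mul_comm]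
    _ = ∫⁻ θ, ∫⁻ x, F (g θ * x) ∂μ ∂ν :=
        lintegral_congr fun θ => (lintegral_mul_left_eq_self _ _).symm
    _ = ∫⁻ x, ∫⁻ θ, F (g θ * x) ∂ν ∂μ :=
        (lintegral_lintegral_swap (f := fun x θ => F (g θ * x))
          (hF.comp measurable_swap).aemeasurable).symm
    _ ≤ ∫⁻ _x, c ∂μ := lintegral_mono fun x => hc x
    _ = c := by rw [lintegral_const, measure_univ, mul_one]

/-- A constant is a trigonometric polynomial of every degree. -/
private theorem trigPoly_const (D : ℕ) (x : ℝ) :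
    ∃ a : ℤ → ℂ, ∀ t : ℝ, ((x : ℝ) : ℂ) =
      ∑ k ∈ Finset.Icc (-(D : ℤ)) D, a k * Complex.exp ((k : ℂ) * (t : ℂ) * Complex.I) := by
  refine ⟨fun k => if k = 0 then (x : ℂ) else 0, fun t => ?_⟩
  simp only [ite_mul, zero_mul, Finset.sum_ite_eq', Finset.mem_Icc]
  simp

/-- STUB 6 (THE LEAD'S STUB, size M–L): word coupling + ontoness — a surjective word and the flat-torus small
balls give `FibreSmallBalls`. -/
theorem stub_haarSmallBalls : ∀ T : ℝ → SU3,
    (∀ θ : ℝ, ((T θ : SU3) : Matrix (Fin 3) (Fin 3) ℂ) =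
      Matrix.diagonal ![Complex.exp (θ * Complex.I), Complex.exp (-(θ * Complex.I)), 1]) →
    (∃ (d : ℕ) (V : Fin d → SU3), ∀ g : SU3, ∃ s : Fin d → ℝ,
      g = (List.ofFn fun j => V j * T (s j) * (V j)⁻¹).prod) →
    (∀ (m D : ℕ), ∃ C c : ℝ, 0 < C ∧ 0 < c ∧ ∀ q : (Fin m → ℝ) → ℝ, Continuous q → (∀ θ, 0 ≤ q θ) →
      (∀ (θ : Fin m → ℝ) (j : Fin m), ∃ a : ℤ → ℂ, ∀ t : ℝ, ((q (Function.update θ j t) : ℝ) : ℂ) =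
        ∑ k ∈ Finset.Icc (-(D : ℤ)) D, a k * Complex.exp ((k : ℂ) * (t : ℂ) * Complex.I)) →
      ∀ θ₀ : Fin m → ℝ, 0 < q θ₀ → ∀ η : ℝ, 0 < η →
        (volume {θ ∈ Set.Icc (fun _ : Fin m => -π) (fun _ => π) | q θ ≤ η * q θ₀}).toReal ≤ C * η ^ c) →
    ∀ (D n : ℕ), ∃ C c : ℝ, 0 < C ∧ 0 < c ∧
      ∀ (E : Type) [Fintype E] [DecidableEq E] (ι : Type) [Fintype ι] (r : ι → E), Fintype.card ι ≤ n →
      ∀ F : (E → SU3) → ℝ, Continuous F → (∀ W, 0 ≤ F W) →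
        (∀ W W' : E → SU3, (∀ i, W (r i) = W' (r i)) → F W = F W') →
        (∀ (W : E → SU3) (i : ι) (A B : SU3), ∃ a : ℤ → ℂ, ∀ t : ℝ,
          ((F (Function.update W (r i) (A * T t * B)) ^ 2 : ℝ) : ℂ) =
            ∑ k ∈ Finset.Icc (-(D : ℤ)) D, a k * Complex.exp ((k : ℂ) * (t : ℂ) * Complex.I)) →
        ∀ W₀ : E → SU3, 0 < F W₀ → ∀ ε : ℝ, 0 < ε →
          ((Measure.pi fun _ : E => haarProbability SU3) {W | F W ≤ ε * F W₀}).toReal ≤ C * ε ^ c := by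
  intro T hT hW hTSB D n
  obtain ⟨d, V, hV⟩ := hW
  have hTc : Continuous T := continuous_of_coe_eq' T hT
  -- the word map
  obtain ⟨word, hword⟩ : ∃ word : (Fin d → ℝ) → SU3,
      ∀ s, word s = (List.ofFn fun j => V j * T (s j) * (V j)⁻¹).prod := ⟨_, fun _ => rfl⟩
  have hword_cont : Continuous word := by
    have : word = fun s => ((List.finRange d).map fun j => V j * T (s j) * (V j)⁻¹).prod := by
      funext s; rw [hword, List.ofFn_eq_map]
    rw [this]
    exact continuous_list_prod _ fun j _ =>
      (continuous_const.mul (hTc.comp (continuous_apply j))).mul continuous_const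
  have hVw : ∀ g : SU3, ∃ s : Fin d → ℝ, word s = g := fun g => by
    obtain ⟨s, hs⟩ := hV g; exact ⟨s, by rw [hword, hs]⟩
  -- constants from the torus estimate, uniform over `m ≤ M := n * d`
  choose Cf cf hCf hcf hTS using fun m => hTSB m D
  set M : ℕ := n * d with hM
  set C : ℝ := 1 + ∑ m ∈ Finset.range (M + 1), Cf m with hC
  set c : ℝ := (Finset.range (M + 1)).inf' ⟨0, by simp⟩ cf with hc
  have hc0 : 0 < c := by
    rw [hc, Finset.lt_inf'_iff]; exact fun m _ => hcf m
  have hC1 : 1 ≤ C := by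
    rw [hC]; linarith [Finset.sum_nonneg fun m (_ : m ∈ Finset.range (M + 1)) => (hCf m).le]
  refine ⟨C, c, by linarith, hc0, ?_⟩
  intro E _ _ ι _ r hcard F hFc hF0 hdep hband W₀ hW₀ ε hε
  classical
  -- angles indexed by `Fin m`
  set m : ℕ := Fintype.card (ι × Fin d) with hm
  have hmM : m ≤ M := by
    rw [hm, hM, Fintype.card_prod, Fintype.card_fin]; exact Nat.mul_le_mul_right d hcard
  have hCm : Cf m ≤ C := by
    have : Cf m ≤ ∑ m' ∈ Finset.range (M + 1), Cf m' :=
      Finset.single_le_sum (fun m' _ => (hCf m').le) (Finset.mem_range.2 (Nat.lt_succ_of_le hmM))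
    rw [hC]; linarith
  have hcm : c ≤ cf m := by
    rw [hc]; exact Finset.inf'_le _ (Finset.mem_range.2 (Nat.lt_succ_of_le hmM))
  set σ : ι × Fin d ≃ Fin m := Fintype.equivFin (ι × Fin d) with hσ
  -- translation elements
  obtain ⟨gθ, hgθ⟩ : ∃ gθ : (Fin m → ℝ) → E → SU3, ∀ θ e, gθ θ e =
      if hx : ∃ i, r i = e then word (fun j => θ (σ (Classical.choose hx, j))) else 1 :=
    ⟨fun θ e => if hx : ∃ i, r i = e then word (fun j => θ (σ (Classical.choose hx, j))) else 1,
      fun _ _ => rfl⟩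
  have hg_cont : Continuous gθ := by
    refine continuous_pi fun e => ?_
    by_cases hx : ∃ i, r i = e
    · simp only [hgθ, dif_pos hx]
      exact hword_cont.comp (continuous_pi fun j => continuous_apply _)
    · simp only [hgθ, dif_neg hx]
      exact continuous_const
  -- the measure and the maximiser
  set μ : Measure (E → SU3) := Measure.pi fun _ => haarProbability SU3 with hμ
  haveI : IsProbabilityMeasure μ := by rw [hμ]; infer_instance
  haveI : μ.IsMulLeftInvariant := by rw [hμ]; infer_instance
  obtain ⟨W₁, -, hW₁⟩ := isCompact_univ.exists_isMaxOn univ_nonempty hFc.continuousOn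
  have hmax : ∀ x, F x ≤ F W₁ := fun x => hW₁ (mem_univ x)
  have hW₁pos : 0 < F W₁ := hW₀.trans_le (hmax W₀)
  -- the sublevel set
  set A : Set (E → SU3) := {W | F W ≤ ε * F W₀} with hA
  have hAclosed : IsClosed A := isClosed_le hFc continuous_const
  have hAm : MeasurableSet A := hAclosed.measurableSet
  -- changing one angle = one move `A T(t) B` at one listed coordinate (or nothing at all)
  have hmove : ∀ (W' : E → SU3) (θ : Fin m → ℝ) (k : Fin m),
      (∀ t, gθ (Function.update θ k t) = gθ θ) ∨
      ∃ (i : ι) (A' B' : SU3), ∀ t, gθ (Function.update θ k t) * W' =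
        Function.update (gθ θ * W') (r i) (A' * T t * B') := by
    intro W' θ k
    obtain ⟨⟨i, j⟩, rfl⟩ := σ.surjective k
    have hex : ∃ i', r i' = r i := ⟨i, rfl⟩
    have hoff : ∀ (y : ℝ) (e : E), (e = r i → Classical.choose hex ≠ i) →
        gθ (Function.update θ (σ (i, j)) y) e = gθ θ e := by
      intro y e he
      rw [hgθ, hgθ]
      by_cases hx : ∃ i', r i' = e
      · rw [dif_pos hx, dif_pos hx]
        congr 1
        funext j'
        refine Function.update_of_ne (fun hk => ?_) _ _
        have h1 : Classical.choose hx = i := (Prod.mk.inj (σ.injective hk)).1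
        have h2 := Classical.choose_spec hx
        rw [h1] at h2
        subst h2
        exact he rfl h1
      · rw [dif_neg hx, dif_neg hx]
    by_cases hsel : Classical.choose hex = i
    · right
      obtain ⟨A, B', hAB⟩ := prod_ofFn_update' d (fun j' => V j' * T (θ (σ (i, j'))) * (V j')⁻¹) j
      refine ⟨i, A * V j, (V j)⁻¹ * B' * W' (r i), fun y => ?_⟩
      funext e
      by_cases he : e = r i
      · subst he
        have hupdσ : (fun j' => Function.update θ (σ (i, j)) y (σ (i, j'))) =
            Function.update (fun j' => θ (σ (i, j'))) j y := by
          funext j'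
          by_cases hj : j' = j
          · subst hj; simp
          · rw [Function.update_of_ne hj, Function.update_of_ne]
            exact fun h => hj (Prod.mk.inj (σ.injective h)).2
        have hfac : (fun j' => V j' * T (Function.update (fun j' => θ (σ (i, j'))) j y j') * (V j')⁻¹) =
            Function.update (fun j' => V j' * T (θ (σ (i, j'))) * (V j')⁻¹) j (V j * T y * (V j)⁻¹) :=
          funext fun j' => Function.apply_update (fun j' x => V j' * T x * (V j')⁻¹) _ j y j'
        rw [Function.update_self, Pi.mul_apply, hgθ, dif_pos hex, hsel, hupdσ, hword, hfac, hAB]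
        simp only [mul_assoc]
      · rw [Function.update_of_ne he, Pi.mul_apply, Pi.mul_apply, hoff y e fun h => absurd h he]
    · left
      intro t
      exact funext fun e => hoff t e fun _ => hsel
  -- every fibre reaches the maximiser on the listed coordinates
  have hreach : ∀ W' : E → SU3, ∃ θs : Fin m → ℝ, ∀ i, (gθ θs * W') (r i) = W₁ (r i) := by
    intro W'
    choose sf hsf using hVw
    refine ⟨fun k => sf (W₁ (r (σ.symm k).1) * (W' (r (σ.symm k).1))⁻¹) (σ.symm k).2, fun i => ?_⟩
    have key : ∀ hx : ∃ i', r i' = r i,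
        word (fun j => sf (W₁ (r (σ.symm (σ (Classical.choose hx, j))).1) *
          (W' (r (σ.symm (σ (Classical.choose hx, j))).1))⁻¹) (σ.symm (σ (Classical.choose hx, j))).2) *
          W' (r i) = W₁ (r i) := by
      intro hx
      simp only [Equiv.symm_apply_apply]
      rw [Classical.choose_spec hx, show (fun j => sf (W₁ (r i) * (W' (r i))⁻¹) j) =
        sf (W₁ (r i) * (W' (r i))⁻¹) from rfl, hsf, inv_mul_cancel_right]
    rw [Pi.mul_apply, hgθ, dif_pos ⟨i, rfl⟩]
    exact key _
  -- joint measurability of the translated indicator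
  have hind : Measurable fun p : (Fin m → ℝ) × (E → SU3) =>
      A.indicator (1 : (E → SU3) → ℝ≥0∞) (gθ p.1 * p.2) := by
    have hS : MeasurableSet {p : (Fin m → ℝ) × (E → SU3) | gθ p.1 * p.2 ∈ A} :=
      (hAclosed.preimage ((hg_cont.comp continuous_fst).mul continuous_snd)).measurableSet
    have : (fun p : (Fin m → ℝ) × (E → SU3) => A.indicator (1 : (E → SU3) → ℝ≥0∞) (gθ p.1 * p.2)) =
        {p : (Fin m → ℝ) × (E → SU3) | gθ p.1 * p.2 ∈ A}.indicator 1 := by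
      funext p
      simp only [Set.indicator_apply, Set.mem_setOf_eq, Pi.one_apply]
    rw [this]
    exact measurable_one.indicator hS
  -- the fibre bound
  set box : Set (Fin m → ℝ) := Icc (fun _ : Fin m => -π) (fun _ => π) with hbox
  have hbox_vol : volume box = ENNReal.ofReal (π + π) ^ m := by
    rw [hbox, Real.volume_Icc_pi]
    simp only [sub_neg_eq_add, Finset.prod_const, Finset.card_univ, Fintype.card_fin]
  have hbox_top : volume box ≠ ∞ := by
    rw [hbox_vol]; exact ENNReal.pow_ne_top ENNReal.ofReal_ne_top
  have hfib : ∀ W' : E → SU3,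
      ∫⁻ θ in box, A.indicator (1 : (E → SU3) → ℝ≥0∞) (gθ θ * W') ≤
        ENNReal.ofReal (Cf m * (ε ^ 2) ^ cf m) := by
    intro W'
    -- the fibre function
    set q : (Fin m → ℝ) → ℝ := fun θ => F (gθ θ * W') ^ 2 with hq
    have hqc : Continuous q := (hFc.comp (hg_cont.mul continuous_const)).pow 2
    have hq0 : ∀ θ, 0 ≤ q θ := fun θ => sq_nonneg _
    have hqband : ∀ (θ : Fin m → ℝ) (k : Fin m), ∃ a : ℤ → ℂ, ∀ t : ℝ,
        ((q (Function.update θ k t) : ℝ) : ℂ) =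
          ∑ l ∈ Finset.Icc (-(D : ℤ)) D, a l * Complex.exp ((l : ℂ) * (t : ℂ) * Complex.I) := by
      intro θ k
      rcases hmove W' θ k with hconst | ⟨i, A', B', hmv⟩
      · obtain ⟨a, ha⟩ := trigPoly_const D (q θ)
        refine ⟨a, fun t => ?_⟩
        rw [← ha t, hq]
        simp only [hconst t]
      · obtain ⟨a, ha⟩ := hband (gθ θ * W') i A' B'
        refine ⟨a, fun t => ?_⟩
        rw [← ha t, hq]
        simp only [hmv t]
    obtain ⟨θs, hθs⟩ := hreach W'
    have hqs : q θs = F W₁ ^ 2 := by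
      rw [hq]; simp only [hdep (gθ θs * W') W₁ hθs]
    have hqs0 : 0 < q θs := by rw [hqs]; positivity
    have hε2 : 0 < ε ^ 2 := by positivity
    have hCfm : 0 < Cf m := hCf m
    have hTSm := hTS m q hqc hq0 hqband θs hqs0 (ε ^ 2) hε2
    -- the fibre sublevel set sits inside the torus sublevel set
    set Sθ : Set (Fin m → ℝ) := {θ | gθ θ * W' ∈ A} with hSθ
    have hSθm : MeasurableSet Sθ := (hAclosed.preimage (hg_cont.mul continuous_const)).measurableSet
    have hsub : Sθ ∩ box ⊆ {θ ∈ box | q θ ≤ ε ^ 2 * q θs} := by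
      rintro θ ⟨hθA, hθbox⟩
      refine ⟨hθbox, ?_⟩
      have h1 : F (gθ θ * W') ≤ ε * F W₀ := hθA
      have h2 : ε * F W₀ ≤ ε * F W₁ := mul_le_mul_of_nonneg_left (hmax W₀) hε.le
      rw [hqs, hq]
      calc F (gθ θ * W') ^ 2 ≤ (ε * F W₁) ^ 2 := pow_le_pow_left₀ (hF0 _) (h1.trans h2) 2
        _ = ε ^ 2 * F W₁ ^ 2 := by ring
    have hfin : volume {θ ∈ box | q θ ≤ ε ^ 2 * q θs} ≠ ∞ :=
      ne_top_of_le_ne_top hbox_top (measure_mono fun θ h => h.1)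
    have hind1 : (fun θ => A.indicator (1 : (E → SU3) → ℝ≥0∞) (gθ θ * W')) = Sθ.indicator 1 := by
      funext θ
      simp only [Set.indicator_apply, hSθ, Set.mem_setOf_eq, Pi.one_apply]
    calc ∫⁻ θ in box, A.indicator (1 : (E → SU3) → ℝ≥0∞) (gθ θ * W')
        = ∫⁻ θ in box, Sθ.indicator 1 θ := by rw [hind1]
      _ = volume (Sθ ∩ box) := by rw [lintegral_indicator_one hSθm, Measure.restrict_apply hSθm]
      _ ≤ volume {θ ∈ box | q θ ≤ ε ^ 2 * q θs} := measure_mono hsub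
      _ ≤ ENNReal.ofReal (Cf m * (ε ^ 2) ^ cf m) :=
          (ENNReal.le_ofReal_iff_toReal_le hfin (by positivity)).2 hTSm
  -- the coupling
  have hcoup := lintegral_le_of_fibre μ ((volume : Measure (Fin m → ℝ)).restrict box) gθ
    (A.indicator (1 : (E → SU3) → ℝ≥0∞)) hind _ hfib
  rw [Measure.restrict_apply_univ, lintegral_indicator_one hAm, hbox_vol] at hcoup
  have h1box : (1 : ℝ≥0∞) ≤ ENNReal.ofReal (π + π) ^ m :=
    one_le_pow_of_one_le' (ENNReal.one_le_ofReal.2 (by linarith [Real.pi_gt_three])) m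
  have hCfm : 0 < Cf m := hCf m
  have hμA : μ A ≤ ENNReal.ofReal (Cf m * (ε ^ 2) ^ cf m) :=
    le_trans (by simpa using mul_le_mul' h1box (le_refl (μ A))) hcoup
  have hreal : (μ A).toReal ≤ Cf m * (ε ^ 2) ^ cf m :=
    ENNReal.toReal_le_of_le_ofReal (by positivity) hμA
  -- constants
  show (μ A).toReal ≤ C * ε ^ c
  by_cases hε1 : ε ≤ 1
  · have hexp : (ε ^ 2) ^ cf m ≤ ε ^ c := by
      rw [← Real.rpow_two, ← Real.rpow_mul hε.le]
      exact Real.rpow_le_rpow_of_exponent_ge hε hε1 (by nlinarith [hcf m])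
    calc (μ A).toReal ≤ Cf m * (ε ^ 2) ^ cf m := hreal
      _ ≤ C * ε ^ c := mul_le_mul hCm hexp (by positivity) (by linarith)
  · push Not at hε1
    have h1 : (μ A).toReal ≤ 1 := ENNReal.toReal_le_of_le_ofReal zero_le_one (by
      rw [ENNReal.ofReal_one]; exact prob_le_one)
    have h2 : (1 : ℝ) ≤ ε ^ c := Real.one_le_rpow hε1.le hc0.le
    nlinarith

end Summit.QuantumFields.QCD.Theorems.CircleTransport
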